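import Literature.Analysis.FluidPDE.SereginSverakLocalEnergy
import Literature.Analysis.FluidPDE.SereginSverakGradientEnergy
import Literature.Analysis.FluidPDE.PressureDecayEstimateProofs
import HarnessLib

/-!
# Seregin–Šverák 2009, Lemma 3.5, discharged: `ScaledEnergyBound_holds`

G. Seregin, V. Šverák, *On Type I singularities of the local axi-symmetric solutions of the
Navier–Stokes equations*, Comm. PDE 34 (2009), 171–201 = arXiv:0804.1803 (page and label
references are to the arXiv version), Lemma 3.5 (p. 9, (as4)–(as5)): under the assumptions of
Theorem 3.1 — the standing assumptions of §3 (`v ∈ L₃(Q)`, `q ∈ L_{3/2}(Q)` solving the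
Navier–Stokes system in `Q = 𝒞 × ]-1, 0[` in the sense of distributions), axial symmetry and the
Type I bound (r3) `|v| ≤ C/√(-t)` — one has
`A(z_b, r; v) + E(z_b, r; v) + C(z_b, r; v) + D(z_b, r; q) ≤ C₁` for all `z_b = (b e₃, 0)`,
`|b| ≤ 1/4`, `0 < r < 1/4`. The statement is the named fact
`SereginSverak2009.ScaledEnergyBound` of `SereginSverakAxisymmetric.lean` (first hypothesis of
the assembly `Literature.Barriers.NavierStokesRegularity.axisymmetricTypeIExclusion_of_leaves`
of the barrier `AxisymmetricTypeIExclusion` = Thm. 3.1). This file closes it.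

The printed proof (pp. 9–10) combines four inputs — (as6) `A(0, 3/4) + E(0, 3/4) ≤ C₂`
(Lemma 3.3 with Remark 3.4), (as11) the absorption of the cubic term (from the multiplicative
inequality (as2), (as7)–(as10) and Young's inequality), (as12) the local energy inequality and
(as13) the decay estimate for the pressure — and iterates `ℰ(ϑ r) ≤ ½ ℰ(r) + f₃`. Every piece is
already a theorem of the tree:

* the iteration `ScaledEnergyBound.of_inputs` (`SereginSverakScaledEnergy.lean`), packaged with
  (as11) `CubicAbsorption_holds` (`SereginSverakScaledEnergyProofs.lean`) and (as12)
  `LocalEnergyEstimate_holds` (`SereginSverakLocalEnergy.lean`, from Remark 3.4 =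
  `SuitableOfBounded_holds`) as `ScaledEnergyBound.of_gradientEnergyBound_of_pressureDecay`;
* (as6) `GradientEnergyBound_holds` (`SereginSverakGradientEnergy.lean`);
* (as13) in ball form, `seregin_sverak_pressure_decay_holds` (`PressureDecayEstimateProofs.lean`,
  Calderón–Zygmund at exponent `3/2`), transported to the coordinate cylinders `𝒞(x₀, r)` by
  `SereginSverak2009.pressureDecay_of_seregin_sverak_pressure_decay`
  (`SereginSverakPressureDecayBalls.lean`).

This file only composes them: `PressureDecay_holds` ((as13) in the form `PressureDecay` of
`SereginSverakScaledEnergy.lean`) and `ScaledEnergyBound_holds`. Consequence recorded elsewhere: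
Prop. 3.7 (`AxisDecayBound`) now depends on the off-axis bound `OffAxisBound` alone
(`axisDecayBound_of_offAxisBound`, `SereginSverakAxisymmetricProofs.lean`).

Not here: Lemma 3.6 (the Thm. 3.2 analogue; its uniform form `ScaledEnergyBound36_holds` is in
`SereginSverakBlowupDecayProofs.lean`), Prop. 3.7, §4.

## References

* G. Seregin, V. Šverák, Comm. PDE 34 (2009), 171–201, arXiv:0804.1803: Lemma 3.5 (p. 9) and its
  proof, (as6)–(as13) (pp. 9–10). [`SereginSverak2009`]
-/

noncomputable section

namespace Literature.Analysis.FluidPDE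

namespace SereginSverak2009

/-- **Seregin–Šverák 2009, proof of Lemma 3.5, (as13), discharged**: the decay estimate for the
pressure, `D(z_b, ϱ; q) ≤ c [(ϱ/r) D(z_b, r; q) + (r/ϱ)² C(z_b, r; v)]` for `z_b = (b e₃, 0)`,
`|b| ≤ 1/4`, `0 < r < 1/4`, `0 < ϱ ≤ r` (the named fact `PressureDecay`), from the proved ball
form `seregin_sverak_pressure_decay_holds` through
`pressureDecay_of_seregin_sverak_pressure_decay`.
[cite: SereginSverak2009, proof of Lemma 3.5, (as13) (arXiv p. 10)] -/
theorem PressureDecay_holds : PressureDecay :=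
  pressureDecay_of_seregin_sverak_pressure_decay seregin_sverak_pressure_decay_holds

/-- **Seregin–Šverák 2009, Lemma 3.5, discharged** (arXiv p. 9: "Under assumptions of
Theorem 3.1, we have the estimate `A(z_b,r;v) + E(z_b,r;v) + C(z_b,r;v) + D(z_b,r;q) ≤ C₁ < +∞`
for all `z_b = (b e₃, 0)`, `b ∈ ℝ`, `|b| ≤ 1/4`, `0 < r < 1/4`"; the named fact
`ScaledEnergyBound`, rendered with a weak spatial gradient `G = ∇v` on `Q` and without the
uniformity of `C₁`). Proof as printed (pp. 9–10): (as6) `GradientEnergyBound_holds`, (as11) and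
(as12) inside `ScaledEnergyBound.of_gradientEnergyBound_of_pressureDecay`, (as13)
`PressureDecay_holds`, and the iteration `ℰ(ϑ r) ≤ ½ ℰ(r) + f₃` of `ScaledEnergyBound.of_inputs`.
[cite: SereginSverak2009, Lemma 3.5 (arXiv p. 9) and its proof (pp. 9–10)] -/
theorem ScaledEnergyBound_holds : ScaledEnergyBound :=
  ScaledEnergyBound.of_gradientEnergyBound_of_pressureDecay GradientEnergyBound_holds
    PressureDecay_holds

end SereginSverak2009

end Literature.Analysis.FluidPDE
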